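import Summits.ResolutionOfSingularities.ResolutionOfSingularities.Theorems.FrobeniusLadderFInjectiveMacaulayficationPConeOffVertex
import Summits.ResolutionOfSingularities.ResolutionOfSingularities.Theorems.FrobeniusLadderFInjectiveMacaulayficationCIFedderAtMaximalIdeal
import Summits.ResolutionOfSingularities.ResolutionOfSingularities.Theorems.FrobeniusLadderFInjectiveMacaulayficationThreefoldG3Prime
import Mathlib.Algebra.MvPolynomial.PDeriv
import Mathlib.RingTheory.MvPolynomial.IrreducibleQuadratic
import HarnessLib

/-!
# Stalk data for `T⁽⁴⁾⁺ = V(Φ−y²−x³, z²+Φ³+w⁷+v⁸+x¹²) ⊂ 𝔸⁶`: primality of `F₁`, the expected dimension, and the five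
# Jacobian minors (crux `FInjectiveMacaulayfication`, K-T4, «T4plus hoff», algebraic half)

Support file for crux stmt-ResolutionOfSingularities-15315 (`FrobeniusLadder.FInjectiveMacaulayfication`), chain w45a,
seat res-L1-w45a-stub-4 (res-L1-w45a-plan-1 R12.9 (b) «GO T4plus hoff», deliverable 2, first of two files). [OURS · L1
W4.5a] — NOT a statement of the manuscript [claim: Hironaka2017]; AI-written, weaker than expert review.

`F₁ = Φ − y² − x³`, `F₂ = z² + Φ³ + w⁷ + v⁸ + x¹²` in `k[x,y,z,w,v,Φ] = MvPolynomial (Fin 6) k` (this order, stub-6's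
`T4PlusPrime` convention), any field `k`. The characteristic-free inputs of the `hoff` binder `T4PlusOffStratum.t4Plus_hoff_char7`:

* §1 `prime_F₁` (`F₁` is linear in `Φ` with unit coefficient), `F₁_not_dvd_F₂` (evaluate at `(0,0,1,0,0,0)`);
* §2 `ringKrullDim_stalk_add_two` — `dim (k[X]/(F₁,F₂))_Q + 2 = 6` at every maximal `Q` (two cuts in `k[X]_P` by
  `PConeOffVertex.ringKrullDim_two_cuts`, the pattern of `T11PlusOffStratum.ringKrullDim_stalk_add_two`);
* §3 the five `2 × 2` minors of `∂(F₁,F₂)/∂(x,y,z,w,v,Φ)` used by the Jacobian regimes: `(z,Φ) ↦ −2z`, `(v,Φ) ↦ −8v⁷`,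
  `(y,Φ) ↦ −6yΦ²`, `(x,y) ↦ 24x¹¹y`, `(x,Φ) ↦ −(9x²Φ² + 12x¹¹)` (`minor_zP`, `minor_vP`, `minor_yP`, `minor_xy`, `minor_xP`),
  and `C_mul_not_mem`.

No definitions, no named facts; glue. [folklore]
-/

-- single-problem summit: the doubled namespace component is forced
set_option linter.dupNamespace false

noncomputable section

namespace Summit.ResolutionOfSingularities.ResolutionOfSingularities.Theorems.FInjectiveMacaulayfication.T4PlusStalkData

open MvPolynomial IsLocalRing Literature.AlgebraicGeometry.Resolution
open Summit.ResolutionOfSingularities.ResolutionOfSingularities.Theorems.FInjectiveMacaulayfication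
open ThreefoldG3Prime

/-! ## §1 `F₁` is prime and does not divide `F₂` -/

section Algebra

variable {k : Type} [Field k]

/-- `F₁ = Φ − y² − x³` is prime: linear in `Φ` with unit coefficient (`MvPolynomial.irreducible_mul_X_add`). [folklore] -/
theorem prime_F₁ (F₁ : MvPolynomial (Fin 6) k) (hF₁ : F₁ = X 5 - X 1 ^ 2 - X 0 ^ 3) : Prime F₁ := by
  have hlin : F₁ = 1 * X 5 + (-(X 1 ^ 2 + X 0 ^ 3)) := by rw [hF₁]; ring
  have h51 : (5 : Fin 6) ≠ 1 := by decide
  have h50 : (5 : Fin 6) ≠ 0 := by decide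
  have hvc : (5 : Fin 6) ∉ (-(X 1 ^ 2 + X 0 ^ 3) : MvPolynomial (Fin 6) k).vars := by
    rw [vars_neg]
    exact notMem_vars_add (notMem_vars_pow (notMem_vars_X h51) 2) (notMem_vars_pow (notMem_vars_X h50) 3)
  have hirr : Irreducible F₁ := by
    rw [hlin]
    exact irreducible_mul_X_add _ _ 5 one_ne_zero (by rw [vars_one]; exact Finset.notMem_empty _) hvc isRelPrime_one_left
  exact UniqueFactorizationMonoid.irreducible_iff_prime.mp hirr

/-- `F₁ ∤ F₂`: at `(0,0,1,0,0,0)` one has `F₁ = 0`, `F₂ = 1`. [folklore] -/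
theorem F₁_not_dvd_F₂ (F₁ F₂ : MvPolynomial (Fin 6) k)
    (hF₁ : F₁ = X 5 - X 1 ^ 2 - X 0 ^ 3) (hF₂ : F₂ = X 2 ^ 2 + X 5 ^ 3 + X 3 ^ 7 + X 4 ^ 8 + X 0 ^ 12) : ¬ F₁ ∣ F₂ := by
  intro h
  have h1 := map_dvd (MvPolynomial.eval (![0, 0, 1, 0, 0, 0] : Fin 6 → k)) h
  have ha : MvPolynomial.eval (![0, 0, 1, 0, 0, 0] : Fin 6 → k) F₁ = 0 := by simp [hF₁]
  have hc : MvPolynomial.eval (![0, 0, 1, 0, 0, 0] : Fin 6 → k) F₂ = 1 := by simp [hF₂]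
  rw [ha, hc, zero_dvd_iff] at h1
  exact one_ne_zero h1

end Algebra

/-! ## §2 The expected dimension `dim (k[X]/(F₁,F₂))_Q + 2 = 6` -/

section Dimension

variable {k : Type} [Field k]

/-- **The expected-dimension binder** for `T⁽⁴⁾⁺` (same proof as `T11PlusOffStratum.ringKrullDim_stalk_add_two`): two cuts in
`k[X]_P`, `F₁` prime, `F₁ ∤ F₂`. [folklore] -/
theorem ringKrullDim_stalk_add_two (F₁ F₂ : MvPolynomial (Fin 6) k)
    (hF₁ : F₁ = X 5 - X 1 ^ 2 - X 0 ^ 3) (hF₂ : F₂ = X 2 ^ 2 + X 5 ^ 3 + X 3 ^ 7 + X 4 ^ 8 + X 0 ^ 12)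
    (Q : Ideal (MvPolynomial (Fin 6) k ⧸ Ideal.ofList [F₁, F₂])) [Q.IsMaximal] :
    ringKrullDim (Localization.AtPrime Q) + (([F₁, F₂].length : ℕ) : WithBot ℕ∞) = ((6 : ℕ) : WithBot ℕ∞) := by
  haveI hPmax : (Q.comap (Ideal.Quotient.mk (Ideal.ofList [F₁, F₂]))).IsMaximal :=
    Ideal.comap_isMaximal_of_surjective _ Ideal.Quotient.mk_surjective
  set P : Ideal (MvPolynomial (Fin 6) k) := Q.comap (Ideal.Quotient.mk (Ideal.ofList [F₁, F₂])) with hP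
  have hdimR : ringKrullDim (Localization.AtPrime P) = ((6 : ℕ) : WithBot ℕ∞) := by
    rw [IsLocalization.AtPrime.ringKrullDim_eq_height P (Localization.AtPrime P), MvPolynomial.height_eq_of_isMaximal k 6 P]
    norm_cast
  haveI : IsDomain (Localization.AtPrime P) := IsLocalization.isDomain_localization P.primeCompl_le_nonZeroDivisors
  haveI : IsNoetherianRing (Localization.AtPrime P) :=
    IsLocalization.isNoetherianRing P.primeCompl (Localization.AtPrime P) inferInstance
  have hinj : Function.Injective (algebraMap (MvPolynomial (Fin 6) k) (Localization.AtPrime P)) :=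
    IsLocalization.injective (Localization.AtPrime P) P.primeCompl_le_nonZeroDivisors
  have hsub : Ideal.ofList [F₁, F₂] ≤ P := fun r hr => by
    rw [hP, Ideal.mem_comap, Ideal.Quotient.eq_zero_iff_mem.mpr hr]
    exact Q.zero_mem
  have hF₁P : F₁ ∈ P := hsub (Ideal.subset_span (by simp))
  have hF₂P : F₂ ∈ P := hsub (Ideal.subset_span (by simp))
  have hfm : algebraMap _ (Localization.AtPrime P) F₁ ∈ maximalIdeal (Localization.AtPrime P) ∧
      algebraMap _ (Localization.AtPrime P) F₂ ∈ maximalIdeal (Localization.AtPrime P) := by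
    rw [← IsLocalization.AtPrime.map_eq_maximalIdeal P (Localization.AtPrime P)]
    exact ⟨Ideal.mem_map_of_mem _ hF₁P, Ideal.mem_map_of_mem _ hF₂P⟩
  have hprime := prime_F₁ F₁ hF₁
  have hf₁0 : algebraMap _ (Localization.AtPrime P) F₁ ≠ 0 := fun h =>
    hprime.ne_zero (hinj (by rw [map_zero]; exact h))
  have hspan : Ideal.span {algebraMap _ (Localization.AtPrime P) F₁} =
      (Ideal.span {F₁}).map (algebraMap (MvPolynomial (Fin 6) k) (Localization.AtPrime P)) := by
    rw [Ideal.map_span, Set.image_singleton]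
  haveI : (Ideal.span {F₁}).IsPrime := (Ideal.span_singleton_prime hprime.ne_zero).mpr hprime
  have hle : Ideal.span {F₁} ≤ P := (Ideal.span_singleton_le_iff_mem _).mpr hF₁P
  have hp₁ : (Ideal.span {algebraMap _ (Localization.AtPrime P) F₁}).IsPrime := by
    rw [hspan]
    exact Ideal.isPrime_map_of_isLocalizationAtPrime P hle
  have hnot : algebraMap _ (Localization.AtPrime P) F₂ ∉ Ideal.span {algebraMap _ (Localization.AtPrime P) F₁} := by
    intro h
    rw [hspan, IsLocalization.mem_map_algebraMap_iff P.primeCompl (Localization.AtPrime P)] at h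
    obtain ⟨⟨⟨i, hi⟩, ⟨s, hs⟩⟩, h⟩ := h
    dsimp only at h
    rw [← map_mul] at h
    have h' : F₂ * s = i := hinj h
    have hdvd : F₁ ∣ F₂ * s := by
      rw [h']
      exact Ideal.mem_span_singleton.mp hi
    rcases hprime.dvd_or_dvd hdvd with h1 | h1
    · exact F₁_not_dvd_F₂ F₁ F₂ hF₁ hF₂ h1
    · exact hs (hle (Ideal.mem_span_singleton.mpr h1))
  have hcuts := PConeOffVertex.ringKrullDim_two_cuts _ _ hfm.1 hfm.2 hf₁0 hp₁ hnot
  have hIJ : Ideal.span {algebraMap _ (Localization.AtPrime P) F₁} ⊔ Ideal.span {algebraMap _ (Localization.AtPrime P) F₂} =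
      (Ideal.ofList [F₁, F₂]).map (algebraMap (MvPolynomial (Fin 6) k) (Localization.AtPrime P)) := by
    rw [Ideal.map_span, ← Ideal.span_union]
    congr 1
    have hset : {r : MvPolynomial (Fin 6) k | r ∈ [F₁, F₂]} = {F₁, F₂} := by
      ext r
      simp
    rw [hset, Set.image_insert_eq, Set.image_singleton, Set.singleton_union]
  obtain ⟨e₂⟩ := CIFedderAtMaximalIdeal.nonempty_quotLocalizationEquiv (MvPolynomial (Fin 6) k) (Ideal.ofList [F₁, F₂]) Q
  have hdimQ : ringKrullDim (Localization.AtPrime Q) =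
      ringKrullDim (Localization.AtPrime P ⧸ (Ideal.span {algebraMap _ (Localization.AtPrime P) F₁} ⊔
        Ideal.span {algebraMap _ (Localization.AtPrime P) F₂})) := by
    rw [← ringKrullDim_eq_of_ringEquiv e₂, hIJ]
  have h2 : (([F₁, F₂].length : ℕ) : WithBot ℕ∞) = 1 + 1 := by norm_num
  rw [hdimQ, h2, ← add_assoc, hcuts, hdimR]

end Dimension

/-! ## §3 The five Jacobian minors -/

section Minors

variable {k : Type} [Field k]

/-- A prime ideal missing `q` misses `C c * q` for a unit `c`. [folklore] -/
theorem C_mul_not_mem {P : Ideal (MvPolynomial (Fin 6) k)} [P.IsPrime] {c : k} (hc : c ≠ 0) {q : MvPolynomial (Fin 6) k}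
    (hq : q ∉ P) : C c * q ∉ P := by
  intro h
  rcases Ideal.IsPrime.mem_or_mem ‹P.IsPrime› h with h1 | h1
  · exact (Ideal.IsPrime.ne_top ‹P.IsPrime›) (Ideal.eq_top_of_isUnit_mem _ h1 ((isUnit_iff_ne_zero.mpr hc).map C))
  · exact hq h1

/-- The `(z,Φ)`-minor of `∂(F₁,F₂)`: `0·3Φ² − 2z·1 = −2z`. [folklore] -/
theorem minor_zP (Fs : Fin 2 → MvPolynomial (Fin 6) k)
    (hF₀ : Fs 0 = X 5 - X 1 ^ 2 - X 0 ^ 3) (hF₁ : Fs 1 = X 2 ^ 2 + X 5 ^ 3 + X 3 ^ 7 + X 4 ^ 8 + X 0 ^ 12) :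
    pderiv 2 (Fs 0) * pderiv 5 (Fs 1) - pderiv 2 (Fs 1) * pderiv 5 (Fs 0) = C (-2) * X 2 := by
  simp only [hF₀, hF₁, map_add, map_sub, Derivation.leibniz_pow, pderiv_X_self,
    pderiv_X_of_ne (show (5 : Fin 6) ≠ 2 by decide), pderiv_X_of_ne (show (1 : Fin 6) ≠ 2 by decide),
    pderiv_X_of_ne (show (0 : Fin 6) ≠ 2 by decide), pderiv_X_of_ne (show (2 : Fin 6) ≠ 5 by decide),
    pderiv_X_of_ne (show (3 : Fin 6) ≠ 5 by decide), pderiv_X_of_ne (show (4 : Fin 6) ≠ 5 by decide),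
    pderiv_X_of_ne (show (0 : Fin 6) ≠ 5 by decide), pderiv_X_of_ne (show (3 : Fin 6) ≠ 2 by decide),
    pderiv_X_of_ne (show (4 : Fin 6) ≠ 2 by decide), pderiv_X_of_ne (show (1 : Fin 6) ≠ 5 by decide),
    smul_eq_mul, nsmul_eq_mul]
  rw [map_neg, map_ofNat]
  ring

/-- The `(v,Φ)`-minor of `∂(F₁,F₂)`: `0·3Φ² − 8v⁷·1 = −8v⁷`. [folklore] -/
theorem minor_vP (Fs : Fin 2 → MvPolynomial (Fin 6) k)
    (hF₀ : Fs 0 = X 5 - X 1 ^ 2 - X 0 ^ 3) (hF₁ : Fs 1 = X 2 ^ 2 + X 5 ^ 3 + X 3 ^ 7 + X 4 ^ 8 + X 0 ^ 12) :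
    pderiv 4 (Fs 0) * pderiv 5 (Fs 1) - pderiv 4 (Fs 1) * pderiv 5 (Fs 0) = C (-8) * X 4 ^ 7 := by
  simp only [hF₀, hF₁, map_add, map_sub, Derivation.leibniz_pow, pderiv_X_self,
    pderiv_X_of_ne (show (5 : Fin 6) ≠ 4 by decide), pderiv_X_of_ne (show (1 : Fin 6) ≠ 4 by decide),
    pderiv_X_of_ne (show (0 : Fin 6) ≠ 4 by decide), pderiv_X_of_ne (show (2 : Fin 6) ≠ 5 by decide),
    pderiv_X_of_ne (show (3 : Fin 6) ≠ 5 by decide), pderiv_X_of_ne (show (4 : Fin 6) ≠ 5 by decide),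
    pderiv_X_of_ne (show (0 : Fin 6) ≠ 5 by decide), pderiv_X_of_ne (show (2 : Fin 6) ≠ 4 by decide),
    pderiv_X_of_ne (show (3 : Fin 6) ≠ 4 by decide), pderiv_X_of_ne (show (1 : Fin 6) ≠ 5 by decide),
    smul_eq_mul, nsmul_eq_mul]
  rw [map_neg, map_ofNat]
  ring

/-- The `(y,Φ)`-minor of `∂(F₁,F₂)`: `(−2y)(3Φ²) − 0·1 = −6yΦ²`. [folklore] -/
theorem minor_yP (Fs : Fin 2 → MvPolynomial (Fin 6) k)
    (hF₀ : Fs 0 = X 5 - X 1 ^ 2 - X 0 ^ 3) (hF₁ : Fs 1 = X 2 ^ 2 + X 5 ^ 3 + X 3 ^ 7 + X 4 ^ 8 + X 0 ^ 12) :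
    pderiv 1 (Fs 0) * pderiv 5 (Fs 1) - pderiv 1 (Fs 1) * pderiv 5 (Fs 0) = C (-6) * (X 1 * X 5 ^ 2) := by
  simp only [hF₀, hF₁, map_add, map_sub, Derivation.leibniz_pow, pderiv_X_self,
    pderiv_X_of_ne (show (5 : Fin 6) ≠ 1 by decide), pderiv_X_of_ne (show (0 : Fin 6) ≠ 1 by decide),
    pderiv_X_of_ne (show (2 : Fin 6) ≠ 5 by decide), pderiv_X_of_ne (show (3 : Fin 6) ≠ 5 by decide),
    pderiv_X_of_ne (show (4 : Fin 6) ≠ 5 by decide), pderiv_X_of_ne (show (0 : Fin 6) ≠ 5 by decide),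
    pderiv_X_of_ne (show (2 : Fin 6) ≠ 1 by decide), pderiv_X_of_ne (show (3 : Fin 6) ≠ 1 by decide),
    pderiv_X_of_ne (show (4 : Fin 6) ≠ 1 by decide), pderiv_X_of_ne (show (1 : Fin 6) ≠ 5 by decide),
    smul_eq_mul, nsmul_eq_mul]
  rw [map_neg, map_ofNat]
  ring

/-- The `(x,y)`-minor of `∂(F₁,F₂)`: `(−3x²)·0 − 12x¹¹·(−2y) = 24x¹¹y`. [folklore] -/
theorem minor_xy (Fs : Fin 2 → MvPolynomial (Fin 6) k)
    (hF₀ : Fs 0 = X 5 - X 1 ^ 2 - X 0 ^ 3) (hF₁ : Fs 1 = X 2 ^ 2 + X 5 ^ 3 + X 3 ^ 7 + X 4 ^ 8 + X 0 ^ 12) :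
    pderiv 0 (Fs 0) * pderiv 1 (Fs 1) - pderiv 0 (Fs 1) * pderiv 1 (Fs 0) = C 24 * (X 0 ^ 11 * X 1) := by
  simp only [hF₀, hF₁, map_add, map_sub, Derivation.leibniz_pow, pderiv_X_self,
    pderiv_X_of_ne (show (5 : Fin 6) ≠ 0 by decide), pderiv_X_of_ne (show (1 : Fin 6) ≠ 0 by decide),
    pderiv_X_of_ne (show (2 : Fin 6) ≠ 1 by decide), pderiv_X_of_ne (show (5 : Fin 6) ≠ 1 by decide),
    pderiv_X_of_ne (show (3 : Fin 6) ≠ 1 by decide), pderiv_X_of_ne (show (4 : Fin 6) ≠ 1 by decide),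
    pderiv_X_of_ne (show (0 : Fin 6) ≠ 1 by decide), pderiv_X_of_ne (show (2 : Fin 6) ≠ 0 by decide),
    pderiv_X_of_ne (show (3 : Fin 6) ≠ 0 by decide), pderiv_X_of_ne (show (4 : Fin 6) ≠ 0 by decide),
    smul_eq_mul, nsmul_eq_mul]
  rw [map_ofNat]
  ring

/-- The `(x,Φ)`-minor of `∂(F₁,F₂)`: `(−3x²)(3Φ²) − 12x¹¹·1 = −(9x²Φ² + 12x¹¹)`. [folklore] -/
theorem minor_xP (Fs : Fin 2 → MvPolynomial (Fin 6) k)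
    (hF₀ : Fs 0 = X 5 - X 1 ^ 2 - X 0 ^ 3) (hF₁ : Fs 1 = X 2 ^ 2 + X 5 ^ 3 + X 3 ^ 7 + X 4 ^ 8 + X 0 ^ 12) :
    pderiv 0 (Fs 0) * pderiv 5 (Fs 1) - pderiv 0 (Fs 1) * pderiv 5 (Fs 0) =
      C (-1) * (9 * X 0 ^ 2 * X 5 ^ 2 + 12 * X 0 ^ 11) := by
  simp only [hF₀, hF₁, map_add, map_sub, Derivation.leibniz_pow, pderiv_X_self,
    pderiv_X_of_ne (show (5 : Fin 6) ≠ 0 by decide), pderiv_X_of_ne (show (1 : Fin 6) ≠ 0 by decide),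
    pderiv_X_of_ne (show (2 : Fin 6) ≠ 5 by decide), pderiv_X_of_ne (show (3 : Fin 6) ≠ 5 by decide),
    pderiv_X_of_ne (show (4 : Fin 6) ≠ 5 by decide), pderiv_X_of_ne (show (0 : Fin 6) ≠ 5 by decide),
    pderiv_X_of_ne (show (2 : Fin 6) ≠ 0 by decide), pderiv_X_of_ne (show (3 : Fin 6) ≠ 0 by decide),
    pderiv_X_of_ne (show (4 : Fin 6) ≠ 0 by decide), pderiv_X_of_ne (show (1 : Fin 6) ≠ 5 by decide),
    smul_eq_mul, nsmul_eq_mul]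
  rw [map_neg, map_one]
  ring

end Minors

end Summit.ResolutionOfSingularities.ResolutionOfSingularities.Theorems.FInjectiveMacaulayfication.T4PlusStalkData

end
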